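import Literature.NumberTheory.EllipticCurves.PlusSymbolBoundOddMultiplicativeProofs
import HarnessLib

/-!
# `‖[Tᵏ] L_p(E, T)‖_p ≤ max(1, ‖L(E,1)/Ω⁺_f‖_p)` at an ODD multiplicative prime, and `L_p(E, T) ∈ Λ`
# when `L(E, 1) = 0` — unconditionally (INT-AUTO-mult-odd; proofs only)

Topic `NumberTheory/EllipticCurves`; a *proofs* file (theorems only: no definition, no named fact;
D-0014/D-0026), the odd-`p` companion of `PAdicLFunctionIntegralityAtTwoSplitMultProofs`
(INT2-AUTO-sp) and `PAdicLFunctionIntegralityAtTwoNonsplitMultProofs` (INT2-AUTO-ns), for THE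
Mazur–Tate–Teitelbaum function at a multiplicative prime: ANY `L` with `IsSplitMultPAdicLFunctionOf f p L`
(split, `α = a_p = 1`) resp. `IsMultPAdicLFunctionOf f p (−1) L` (non-split, `α = a_p = −1`), `f` the
newform of `E = W/ℚ`, in the tree's normalisation by `Ω⁺_f` (`re Λ_f = ℤ · Ω⁺_f/2`).

THE POINT. The coefficients of `L` are limits of the exact Riemann sums of the (signed) plus-symbol
distribution (`IsSplitMultPAdicLFunctionOf.tendsto_riemannSum_coeff`,
`IsMultPAdicLFunctionOf.tendsto_riemannSum_coeff_of_nonsplit`, MTT §I.13), whose terms are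
`± [a/pᵐ]⁺_f · C(s,k)`; by the UNIFORM symbol bound at an odd `p ∥ N`
(`IsNewformOf.norm_ratPlusSymbol_val_div_le_max_of_multiplicative`: cusp class of `1/p` + the
`U_p`-relation at the cusp `0`) every Riemann sum, hence every coefficient, has norm
`≤ max(1, ‖[0]⁺_f‖_p)` with `[0]⁺_f = L(E,1)/Ω⁺_f` — and `≤ 1` when `L(E,1) = 0` (in particular in
positive analytic rank), i.e. `L ∈ ι(Λ)`, `Λ = ℤ_p⟦T⟧`. NO hypothesis on `E[p]` (reducible allowed),
the `p`-adic image, optimality or the Manin constant; compare `padicLFunction_mem_integral_of`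
(good ordinary, `E[p]` irreducible; Greenberg–Vatsal 2000 Prop. 3.7) and Wuthrich 2014 (integrality
of the Néron-normalised function for semistable `E`), neither of which is used.

* `norm_coeff_le_max_of_isMultPAdicLFunctionOf_neg_one`, `norm_coeff_le_max_of_isSplitMultPAdicLFunctionOf`
  — `‖[Tᵏ]L‖_p ≤ max(1, ‖[0]⁺_f‖_p)` for all `k`;
* `norm_coeff_le_one_of_isMultPAdicLFunctionOf_neg_one_of_analyticRank_ne_zero`,
  `norm_coeff_le_one_of_isSplitMultPAdicLFunctionOf_of_analyticRank_ne_zero` — `≤ 1` when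
  `W.analyticRank ≠ 0`;
* `exists_iwasawaToPowerSeries_eq_of_isMultPAdicLFunctionOf_neg_one_of_analyticRank_ne_zero`,
  `exists_iwasawaToPowerSeries_eq_of_isSplitMultPAdicLFunctionOf_of_analyticRank_ne_zero` —
  `L = ι L₀`, `L₀ ∈ Λ` (`exists_iwasawaToPowerSeries_eq_iff_norm_coeff_le_one`).

Requested by the residual cell `b2b-bsdres` (CLASS-CLOSURE lane, class O9 = X2c — reducible `E[p]`,
multiplicative `p`, analytic rank one; typer cc-typer-6 GEN 10): the `Λ`-membership datum `hι` of the
`(μ, λ)` machinery (`X11a.InvariantsAt`, `Iwasawa.UnitCoeffAt` consumers) for THE multiplicative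
function is thereby a theorem on every O9 / N8 row. Nothing about any particular curve is asserted.

## References

* B. Mazur, J. Tate, J. Teitelbaum, *On `p`-adic analogues of the conjectures of Birch and
  Swinnerton-Dyer*, Invent. Math. 84 (1986), §I.4 (4.2), §I.8, §I.10, §I.12–I.13.
  [MazurTateTeitelbaum1986Invent]
* J. E. Cremona, *Algorithms for modular elliptic curves*, 2nd ed. (1997), §2.2 Lemma 2.2.3, §2.8.
  [CremonaAlgorithms1997]
* R. Greenberg, V. Vatsal, *On the Iwasawa invariants of elliptic curves*, Invent. Math. 142 (2000),
  Prop. (3.7). [GreenbergVatsal2000]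
-/

set_option autoImplicit false

noncomputable section

open scoped MatrixGroups ModularForm

open CongruenceSubgroup WeierstrassCurve Filter Topology
  Literature.NumberTheory.EllipticCurves.ModularForms

namespace Literature.NumberTheory.EllipticCurves

section OddMult

variable {W : WeierstrassCurve ℚ} {p : ℕ} [Fact p.Prime] {N : ℕ} [NeZero N]
  {f : CuspForm (Gamma0 N) 2}

/-- One Riemann-sum term `ε · [x/pʲ]⁺_f · C(s,k)` (`‖ε‖ = 1`) has norm `≤ max(1, ‖[0]⁺_f‖_p)` at an odd
multiplicative prime (private bookkeeping). [folklore] -/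
private theorem norm_term_le_max (hf : IsNewformOf W f) (hp2 : p ≠ 2)
    (hmult : W.HasMultiplicativeReductionAtPrime p) {ε : ℚ_[p]} (hε : ‖ε‖ = 1) (j : ℕ)
    (x : ZMod (p ^ j)) (c : ℕ) :
    ‖ε * (ratPlusSymbol f ((x.val : ℚ) / (p : ℚ) ^ j) : ℚ_[p]) * ((c : ℕ) : ℚ_[p])‖ ≤
      max 1 ‖((ratPlusSymbol f 0 : ℚ) : ℚ_[p])‖ := by
  have hc : ‖((c : ℕ) : ℚ_[p])‖ ≤ 1 := by
    have h := Padic.norm_int_le_one (p := p) ((c : ℕ) : ℤ)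
    rwa [Int.cast_natCast] at h
  rw [norm_mul, norm_mul, hε, one_mul]
  calc _ ≤ max 1 ‖((ratPlusSymbol f 0 : ℚ) : ℚ_[p])‖ * 1 :=
        mul_le_mul (hf.norm_ratPlusSymbol_val_div_le_max_of_multiplicative hp2 hmult j x) hc
          (norm_nonneg _) (le_trans zero_le_one (le_max_left _ _))
    _ = _ := mul_one _

/-- **`‖[Tᵏ] L‖_p ≤ max(1, ‖[0]⁺_f‖_p)` for THE NON-SPLIT multiplicative function at an odd `p`.** For
`E = W/ℚ` non-split multiplicative at an odd prime `p`, `f` its newform (any level) and ANY `L` with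
`IsMultPAdicLFunctionOf f p (−1) L`: the Riemann sums of the signed plus-symbol measure converge to
`[Tᵏ]L` (`IsMultPAdicLFunctionOf.tendsto_riemannSum_coeff_of_nonsplit`), each term has norm
`≤ max(1, ‖[0]⁺_f‖_p)` (`IsNewformOf.norm_ratPlusSymbol_val_div_le_max_of_multiplicative`; the binomials
are integers), sums obey the ultrametric inequality, and closed balls are closed. No hypothesis on
`E[p]`. [cite: MazurTateTeitelbaum1986Invent, §I.10 and §I.12–I.13] [cite: CremonaAlgorithms1997, §2.2 Lemma 2.2.3] -/
theorem norm_coeff_le_max_of_isMultPAdicLFunctionOf_neg_one (hf : IsNewformOf W f) (hp2 : p ≠ 2)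
    (hmult : W.HasMultiplicativeReductionAtPrime p)
    (hns : ¬ W.HasSplitMultiplicativeReductionAtPrime p)
    {L : PowerSeries ℚ_[p]} (hL : IsMultPAdicLFunctionOf f p (-1) L) (k : ℕ) :
    ‖PowerSeries.coeff k L‖ ≤ max 1 ‖((ratPlusSymbol f 0 : ℚ) : ℚ_[p])‖ := by
  classical
  have hlim := hL.tendsto_riemannSum_coeff_of_nonsplit hf hmult hns k
  refine le_of_tendsto hlim.norm (Eventually.of_forall fun n ↦ ?_)
  have hB : (0 : ℝ) ≤ max 1 ‖((ratPlusSymbol f 0 : ℚ) : ℚ_[p])‖ :=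
    le_trans zero_le_one (le_max_left _ _)
  haveI := neZero_torsionOrder p
  haveI : Fintype (rootsOfUnity (torsionOrder p) ℤ_[p]) := Fintype.ofFinite _
  rw [finsum_eq_sum_of_fintype]
  refine IsUltrametricDist.norm_sum_le_of_forall_le_of_nonneg hB fun u _ ↦ ?_
  refine IsUltrametricDist.norm_sum_le_of_forall_le_of_nonneg hB fun s _ ↦ ?_
  exact norm_term_le_max hf hp2 hmult
    (by rw [norm_pow, norm_neg, norm_one, one_pow]) _ _ _

/-- **`‖[Tᵏ] L‖_p ≤ max(1, ‖[0]⁺_f‖_p)` for THE SPLIT multiplicative function at an odd `p`.** Same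
argument with the unsigned measure (`IsSplitMultPAdicLFunctionOf.tendsto_riemannSum_coeff`).
[cite: MazurTateTeitelbaum1986Invent, §I.10 and §I.12–I.13] [cite: CremonaAlgorithms1997, §2.2 Lemma 2.2.3] -/
theorem norm_coeff_le_max_of_isSplitMultPAdicLFunctionOf (hf : IsNewformOf W f) (hp2 : p ≠ 2)
    (hsplit : W.HasSplitMultiplicativeReductionAtPrime p)
    {L : PowerSeries ℚ_[p]} (hL : IsSplitMultPAdicLFunctionOf f p L) (k : ℕ) :
    ‖PowerSeries.coeff k L‖ ≤ max 1 ‖((ratPlusSymbol f 0 : ℚ) : ℚ_[p])‖ := by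
  classical
  have hmult : W.HasMultiplicativeReductionAtPrime p := hsplit.hasMultiplicativeReductionAtPrime
  have hlim := hL.tendsto_riemannSum_coeff hsplit hf k
  refine le_of_tendsto hlim.norm (Eventually.of_forall fun n ↦ ?_)
  have hB : (0 : ℝ) ≤ max 1 ‖((ratPlusSymbol f 0 : ℚ) : ℚ_[p])‖ :=
    le_trans zero_le_one (le_max_left _ _)
  haveI := neZero_torsionOrder p
  haveI : Fintype (rootsOfUnity (torsionOrder p) ℤ_[p]) := Fintype.ofFinite _
  rw [finsum_eq_sum_of_fintype]
  refine IsUltrametricDist.norm_sum_le_of_forall_le_of_nonneg hB fun u _ ↦ ?_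
  refine IsUltrametricDist.norm_sum_le_of_forall_le_of_nonneg hB fun s _ ↦ ?_
  have h := norm_term_le_max hf hp2 hmult (ε := 1) norm_one
    (n + cyclotomicExponent p)
    (PadicInt.toZModPow (n + cyclotomicExponent p) ((u : ℤ_[p]ˣ) : ℤ_[p]) *
      (cyclotomicGenerator p : ZMod (p ^ (n + cyclotomicExponent p))) ^ s.val) (s.val.choose k)
  rwa [one_mul] at h

/-- **INT-AUTO-mult-odd (non-split): `‖[Tᵏ] L‖_p ≤ 1` in positive analytic rank** — `[0]⁺_f = 0` when
`L(E,1) = 0` (`ratPlusSymbol_zero_eq_zero_of_entireLFunction_eq_zero`,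
`apply_eq_zero_of_analyticOrderNatAt_ne_zero`). [cite: MazurTateTeitelbaum1986Invent, §I.10 and §I.12–I.13] -/
theorem norm_coeff_le_one_of_isMultPAdicLFunctionOf_neg_one_of_analyticRank_ne_zero
    (hf : IsNewformOf W f) (hp2 : p ≠ 2) (hmult : W.HasMultiplicativeReductionAtPrime p)
    (hns : ¬ W.HasSplitMultiplicativeReductionAtPrime p) (hr : W.analyticRank ≠ 0)
    {L : PowerSeries ℚ_[p]} (hL : IsMultPAdicLFunctionOf f p (-1) L) (k : ℕ) :
    ‖PowerSeries.coeff k L‖ ≤ 1 := by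
  refine (norm_coeff_le_max_of_isMultPAdicLFunctionOf_neg_one hf hp2 hmult hns hL k).trans
    (max_le le_rfl ?_)
  rw [ratPlusSymbol_zero_eq_zero_of_entireLFunction_eq_zero hf
    (apply_eq_zero_of_analyticOrderNatAt_ne_zero hr), Rat.cast_zero, norm_zero]
  exact zero_le_one

/-- **INT-AUTO-mult-odd (split): `‖[Tᵏ] L‖_p ≤ 1` in positive analytic rank.**
[cite: MazurTateTeitelbaum1986Invent, §I.10 and §I.12–I.13] -/
theorem norm_coeff_le_one_of_isSplitMultPAdicLFunctionOf_of_analyticRank_ne_zero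
    (hf : IsNewformOf W f) (hp2 : p ≠ 2) (hsplit : W.HasSplitMultiplicativeReductionAtPrime p)
    (hr : W.analyticRank ≠ 0) {L : PowerSeries ℚ_[p]} (hL : IsSplitMultPAdicLFunctionOf f p L)
    (k : ℕ) : ‖PowerSeries.coeff k L‖ ≤ 1 := by
  refine (norm_coeff_le_max_of_isSplitMultPAdicLFunctionOf hf hp2 hsplit hL k).trans
    (max_le le_rfl ?_)
  rw [ratPlusSymbol_zero_eq_zero_of_entireLFunction_eq_zero hf
    (apply_eq_zero_of_analyticOrderNatAt_ne_zero hr), Rat.cast_zero, norm_zero]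
  exact zero_le_one

/-- **`L ∈ ι(Λ)`, `Λ = ℤ_p⟦T⟧`, for THE NON-SPLIT multiplicative function at an odd `p` in positive
analytic rank, unconditionally** (`exists_iwasawaToPowerSeries_eq_iff_norm_coeff_le_one`).
[cite: MazurTateTeitelbaum1986Invent, §I.12 (L_p(f) ∈ Λ)] -/
theorem exists_iwasawaToPowerSeries_eq_of_isMultPAdicLFunctionOf_neg_one_of_analyticRank_ne_zero
    (hf : IsNewformOf W f) (hp2 : p ≠ 2) (hmult : W.HasMultiplicativeReductionAtPrime p)
    (hns : ¬ W.HasSplitMultiplicativeReductionAtPrime p) (hr : W.analyticRank ≠ 0)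
    {L : PowerSeries ℚ_[p]} (hL : IsMultPAdicLFunctionOf f p (-1) L) :
    ∃ L₀ : IwasawaAlgebra p, iwasawaToPowerSeries p L₀ = L :=
  (exists_iwasawaToPowerSeries_eq_iff_norm_coeff_le_one _).mpr fun k ↦
    norm_coeff_le_one_of_isMultPAdicLFunctionOf_neg_one_of_analyticRank_ne_zero hf hp2 hmult hns hr hL k

/-- **`L ∈ ι(Λ)` for THE SPLIT multiplicative function at an odd `p` in positive analytic rank,
unconditionally.** [cite: MazurTateTeitelbaum1986Invent, §I.12 (L_p(f) ∈ Λ)] -/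
theorem exists_iwasawaToPowerSeries_eq_of_isSplitMultPAdicLFunctionOf_of_analyticRank_ne_zero
    (hf : IsNewformOf W f) (hp2 : p ≠ 2) (hsplit : W.HasSplitMultiplicativeReductionAtPrime p)
    (hr : W.analyticRank ≠ 0) {L : PowerSeries ℚ_[p]} (hL : IsSplitMultPAdicLFunctionOf f p L) :
    ∃ L₀ : IwasawaAlgebra p, iwasawaToPowerSeries p L₀ = L :=
  (exists_iwasawaToPowerSeries_eq_iff_norm_coeff_le_one _).mpr fun k ↦
    norm_coeff_le_one_of_isSplitMultPAdicLFunctionOf_of_analyticRank_ne_zero hf hp2 hsplit hr hL k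

end OddMult

end Literature.NumberTheory.EllipticCurves

end
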